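import Literature.AlgebraicGeometry.Frobenioids.AutSubAmpleCexBase
import Literature.AlgebraicGeometry.Frobenioids.AutSubAmpleCexMonoids
import Literature.AlgebraicGeometry.Frobenioids.ModelFrobenioidIsFrobenioid
import Literature.AlgebraicGeometry.Frobenioids.FrTrFrobenioid
import HarnessLib

/-!
# [FrdI] Prop. 1.6 (vi) «Aut^sub-ample» counterexample, part 3: the Frobenioid `C` of the witness

Mochizuki, *The geometry of Frobenioids I: the general theory*, Kyushu J. Math. **62** (2008)
293–400, §1, Proposition 1.6 (vi), kurims text p. 27 [cite: MochizukiFrdI2008, Prop. 1.6(vi) p.27]: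

> "(vi) A object of `C′` is Aut-ample (respectively, Aut^sub-ample; End-ample) if it projects to
> such an object of `C`."

OURS (abc-iut cell, finding F-w5d202-1; NOT a construction of the paper): a kernel witness that the
clause «Aut^sub-ample» (direction `C ⇒ C′`, `C′ := C ×_D D′`) is FALSE AS PRINTED under the standing
hypotheses of Prop. 1.6 (p. 27: `C → F_Φ` a Frobenioid over a connected, totally epimorphic `D`, `Φ`
divisorial; `D′ → D` a functor between connected, totally epimorphic categories mapping FSM-morphisms
to FSM-morphisms).  The clauses «Aut-ample»/«End-ample» are PROVED in the tree (abc-iut-found,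
`PreFrobenioid.isAutAmple_fiberProduct_of_fst` / `isEndAmple_fiberProduct_of_fst`); «Aut^sub-ample»
was left open there ("the evident lifting argument needs a sub-automorphism of the `C`-component with
PRESCRIBED projection to `D`", `FiberProductsMorphisms.lean`).  The four files of the witness:
`AutSubAmpleCexBase` (the base `D`, the sub-category `D′`), `AutSubAmpleCexMonoids` (the lexicographic
cones `L₂`, `L₃`), `AutSubAmpleCexFrobenioid` (the divisor monoid `Φ`, `B = 0_D`, the model Frobenioid
`C`, integer coordinates on `L₂^gp`), `AutSubAmpleFiberProductCounterexample` (the objects `A`, `X` and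
the refutation).  Neutral record under the cell's typing; nothing here bears on [IUTchIII] Cor. 3.12.

THIS FILE: the divisor monoid `Φ` on `D` (`Φ(P) = Φ(E₀) = L₂`, `Φ(E₁) = L₃`; an arrow with label `n`
pulls back by `σₙ`, resp. `τₙ`, resp. `τₙ ∘ r`) — a monoid on `D` (Def. 1.1 (ii)), objectwise
divisorial; the trivial rational function monoid `B = 0_D` with `Div_B = 0`; the model Frobenioid
`C := ModelFrobenioid Φ 0_D 0` of Thm. 5.2, a FROBENIOID by `ModelFrobenioid.isFrobenioid`
(abc-iut-found); and the integer coordinates `Ev p q : L₂^gp → ℤ`, `(y, x) ↦ p·y + q·x`, with their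
behaviour under the shears.
-/

noncomputable section

namespace Literature.AlgebraicGeometry.Frobenioids

open CategoryTheory Opposite Function

namespace AutSubAmpleCex

/-! ### The divisor monoid `Φ` on `D` -/

/-- The values of `Φ`: `Φ(P) = Φ(E₀) = L₂`, `Φ(E₁) = L₃`. [cite: MochizukiFrdI2008, Prop. 1.6(vi) p.27] -/
def PhiObj : BObj → CommMonCat.{0}
  | .P => CommMonCat.of L2
  | .E0 => CommMonCat.of L2
  | .E1 => CommMonCat.of L3

/-- The pull-back maps of `Φ`: an arrow with label `n` pulls back by the shear `σₙ`
(resp. `τₙ`, `τₙ ∘ r`). [cite: MochizukiFrdI2008, Prop. 1.6(vi) p.27] -/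
def pullHom : ∀ {A B : BObj}, (B ⟶ A) → ((PhiObj A : Type) →* (PhiObj B : Type))
  | .P, .P, g => L2.shear g.val
  | .P, .E0, g => L2.shear g.val
  | .P, .E1, g => (L3.shear g.val).comp L3.incl
  | .E0, .E0, g => L2.shear g.val
  | .E1, .E1, g => L3.shear g.val
  | .E0, .P, g => (no_P_E0 g).elim
  | .E1, .P, g => (no_P_E1 g).elim
  | .E1, .E0, g => (no_E0_E1 g).elim
  | .E0, .E1, g => (no_E1_E0 g).elim

/-- `pullHom` of an identity. [cite: MochizukiFrdI2008, Prop. 1.6(vi) p.27] -/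
theorem pullHom_id (A : BObj) : pullHom (𝟙 A) = MonoidHom.id _ := by
  cases A
  · exact MonoidHom.ext fun a => L2.shear_zero a
  · exact MonoidHom.ext fun a => L2.shear_zero a
  · exact MonoidHom.ext fun a => L3.shear_zero a

/-- `pullHom` of a composite (contravariance). [cite: MochizukiFrdI2008, Prop. 1.6(vi) p.27] -/
theorem pullHom_comp {A B Z : BObj} (g : Z ⟶ B) (f : B ⟶ A) :
    pullHom (g ≫ f) = (pullHom g).comp (pullHom f) := by
  cases A <;> cases B <;> cases Z <;>
    first
    | exact (no_P_E0 ‹BObj.P ⟶ BObj.E0›).elim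
    | exact (no_P_E1 ‹BObj.P ⟶ BObj.E1›).elim
    | exact (no_E0_E1 ‹BObj.E0 ⟶ BObj.E1›).elim
    | exact (no_E1_E0 ‹BObj.E1 ⟶ BObj.E0›).elim
    | exact MonoidHom.ext fun (a : L2) => by
        change L2.shear _ a = L2.shear _ (L2.shear _ a)
        rw [L2.shear_shear, comp_val, add_comm]
    | exact MonoidHom.ext fun (a : L2) => by
        change L3.shear _ (L3.incl a) = L3.shear _ (L3.incl (L2.shear _ a))
        rw [L3.incl_shear, L3.shear_shear, comp_val, add_comm]
    | exact MonoidHom.ext fun (a : L3) => by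
        change L3.shear _ a = L3.shear _ (L3.shear _ a)
        rw [L3.shear_shear, comp_val, add_comm]

/-- The divisor monoid `Φ : Dᵒᵖ → Mon` of the witness. [cite: MochizukiFrdI2008, Prop. 1.6(vi) p.27] -/
def Phi : BObjᵒᵖ ⥤ CommMonCat.{0} where
  obj X := PhiObj X.unop
  map f := CommMonCat.ofHom (pullHom f.unop)
  map_id X := by
    ext a
    change pullHom (𝟙 X.unop) a = a
    rw [pullHom_id]
    rfl
  map_comp f g := by
    ext a
    change pullHom (g.unop ≫ f.unop) a = pullHom g.unop (pullHom f.unop a)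
    rw [pullHom_comp]
    rfl

/-- `pull Φ f = pullHom f`. [cite: MochizukiFrdI2008, Prop. 1.6(vi) p.27] -/
theorem pull_Phi {A B : BObj} (f : B ⟶ A) : pull Phi f = pullHom f := rfl

/-- `Φ(f)` for `f : P → P`. [cite: MochizukiFrdI2008, Prop. 1.6(vi) p.27] -/
@[simp] theorem Phi_map_PP (f : BObj.P ⟶ BObj.P) : (Phi.map f.op).hom = L2.shear f.val := rfl
/-- `Φ(f)` for `f : E₀ → P`. [cite: MochizukiFrdI2008, Prop. 1.6(vi) p.27] -/
@[simp] theorem Phi_map_E0P (f : BObj.E0 ⟶ BObj.P) : (Phi.map f.op).hom = L2.shear f.val := rfl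
/-- `Φ(f)` for `f : E₀ → E₀`. [cite: MochizukiFrdI2008, Prop. 1.6(vi) p.27] -/
@[simp] theorem Phi_map_E0E0 (f : BObj.E0 ⟶ BObj.E0) : (Phi.map f.op).hom = L2.shear f.val := rfl
/-- `Φ(f)` for `f : E₁ → E₁`. [cite: MochizukiFrdI2008, Prop. 1.6(vi) p.27] -/
@[simp] theorem Phi_map_E1E1 (f : BObj.E1 ⟶ BObj.E1) : (Phi.map f.op).hom = L3.shear f.val := rfl
/-- `Φ(f)` for `f : E₁ → P`. [cite: MochizukiFrdI2008, Prop. 1.6(vi) p.27] -/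
@[simp] theorem Phi_map_E1P (f : BObj.E1 ⟶ BObj.P) :
    (Phi.map f.op).hom = (L3.shear f.val).comp L3.incl := rfl

/-- `Φ` is objectwise divisorial. [cite: MochizukiFrdI2008, Prop. 1.6(vi) p.27] -/
theorem isDivisorial_Phi : Objectwise (fun M _ => IsDivisorial M) Phi := by
  intro A
  cases A
  · exact L2.isDivisorial
  · exact L2.isDivisorial
  · exact L3.isDivisorial

/-- An injective homomorphism into a sharp monoid is characteristically injective (same statement as
`isCharInjective_of_injective_of_isSharp` of `PadicFrobenioidZeroMonoid.lean`, restated here to keep the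
imports of this witness light). [cite: MochizukiFrdI2008, §0 p.11] -/
theorem isCharInjective_of_injective {M N : Type} [CommMonoid M] [CommMonoid N] (φ : M →* N)
    (hφ : Injective φ) (hN : IsSharp N) : IsCharInjective φ := by
  refine ⟨hφ, fun x y hxy => ?_⟩
  obtain ⟨a, rfl⟩ := Associates.mk_surjective x
  obtain ⟨b, rfl⟩ := Associates.mk_surjective y
  rw [associatesMap_mk, associatesMap_mk, Associates.mk_eq_mk_iff_associated] at hxy
  obtain ⟨u, hu⟩ := hxy
  have hu1 : (u : N) = 1 := hN.1 _ u.isUnit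
  rw [hu1, mul_one] at hu
  rw [hφ hu]

/-- `Φ` is a monoid on `D` (Def. 1.1 (ii)): pull-backs are characteristically injective, and bijective
along FSM-morphisms (= endomorphisms). [cite: MochizukiFrdI2008, Prop. 1.6(vi) p.27] -/
theorem isMonoidOn_Phi : IsMonoidOn Phi := by
  refine ⟨fun {A B} f => ?_, fun {A B} f hf => ?_⟩
  · rw [pull_Phi]
    cases A <;> cases B
    · exact isCharInjective_of_injective _ (L2.shear_bijective _).1 L2.isSharp
    · exact isCharInjective_of_injective _ (L2.shear_bijective _).1 L2.isSharp
    · exact isCharInjective_of_injective _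
        ((L3.shear_bijective _).1.comp L3.incl_injective) L3.isSharp
    · exact (no_P_E0 f).elim
    · exact isCharInjective_of_injective _ (L2.shear_bijective _).1 L2.isSharp
    · exact (no_E1_E0 f).elim
    · exact (no_P_E1 f).elim
    · exact (no_E0_E1 f).elim
    · exact isCharInjective_of_injective _ (L3.shear_bijective _).1 L3.isSharp
  · rw [pull_Phi]
    cases A <;> cases B
    · exact L2.shear_bijective _
    · exact (not_isFiberwiseSurjective_E0 f hf.1).elim
    · exact (not_isFiberwiseSurjective_E1 f hf.1).elim
    · exact (no_P_E0 f).elim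
    · exact L2.shear_bijective _
    · exact (no_E1_E0 f).elim
    · exact (no_P_E1 f).elim
    · exact (no_E0_E1 f).elim
    · exact L3.shear_bijective _

/-! ### The (trivial) rational function monoid and the model Frobenioid `C` -/

/-- The rational function monoid of the witness: `B = 0_D`. [cite: MochizukiFrdI2008, Thm. 5.2 p.100] -/
abbrev Bmon : BObjᵒᵖ ⥤ CommMonCat.{0} := zeroMonoid BObj

/-- `Div_B : 0_D → Φ^gp`, the unique homomorphism. [cite: MochizukiFrdI2008, Thm. 5.2 p.100] -/
def DivB : Bmon ⟶ monoidGp Phi where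
  app A := CommMonCat.ofHom 1
  naturality A B f := by
    ext u
    change (1 : Algebra.GrothendieckGroup (Phi.obj B)) = (CommMonCat.Hom.hom ((monoidGp Phi).map f)) 1
    rw [map_one]
    rfl

/-- `Div_B` is trivial. [cite: MochizukiFrdI2008, Thm. 5.2 p.100] -/
@[simp] theorem divB_eq_one (A : BObjᵒᵖ) (u : Bmon.obj A) : divB Phi Bmon DivB A u = 1 := rfl

/-- `0_D` is objectwise group-like. [cite: MochizukiFrdI2008, Thm. 5.2 p.100] -/
theorem isGroupLike_Bmon : Objectwise (fun M _ => IsGroupLike M) Bmon := fun A =>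
  { isPreDivisorial := (isDivisorial_zeroMonoid (D := BObj) A).isPreDivisorial
    subsingleton_associates := ⟨fun a b => by
      obtain ⟨a, rfl⟩ := Associates.mk_surjective a
      obtain ⟨b, rfl⟩ := Associates.mk_surjective b
      rw [Subsingleton.elim a b]⟩ }

/-- The Frobenioid of the witness: the model Frobenioid of `(D, Φ, 0_D)`.
[cite: MochizukiFrdI2008, Thm. 5.2(i) p.100] -/
abbrev Cx : Type := ModelFrobenioid Phi Bmon DivB

/-- Its pre-Frobenioid structure `C → F_Φ`. [cite: MochizukiFrdI2008, Thm. 5.2(i) p.100] -/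
abbrev Fx : Cx ⥤ ElemFrobenioid Phi := ModelFrobenioid.toElem Phi Bmon DivB

/-- `C` is a Frobenioid (Thm. 5.2 (ii)). [cite: MochizukiFrdI2008, Thm. 5.2(ii) p.101] -/
theorem isFrobenioid : PreFrobenioid.IsFrobenioid Fx :=
  ModelFrobenioid.isFrobenioid isMonoidOn_Phi isDivisorial_Phi isMonoidOn_zeroMonoid isGroupLike_Bmon
    isGraphConnected isTotallyEpimorphic

/-! ### Integer coordinates on `L₂^gp` -/

/-- `of a` in a Grothendieck group, lifted along `f`, is `f a`. [cite: MochizukiFrdI2008, §0 p.11] -/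
theorem lift_of {M K : Type} [CommMonoid M] [CommGroup K] (f : M →* K) (a : M) :
    Algebra.GrothendieckGroup.lift f (Algebra.GrothendieckGroup.of a) = f a := by
  have h := Algebra.GrothendieckGroup.lift.symm_apply_apply f
  rw [Algebra.GrothendieckGroup.lift_symm_apply] at h
  exact DFunLike.congr_fun h a

/-- The homomorphism `(y, x) ↦ p·y + q·x` on `L₂`. [cite: MochizukiFrdI2008, Def. 1.1(i) p.19] -/
def L2.ev (p q : ℤ) : L2 →* Multiplicative ℤ where
  toFun a := Multiplicative.ofAdd (p * a.y + q * a.x)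
  map_one' := by simp
  map_mul' a b := by
    rw [← ofAdd_add]
    congr 1
    simp only [L2.mul_y, L2.mul_x]
    ring

/-- `ev` on elements. [cite: MochizukiFrdI2008, Def. 1.1(i) p.19] -/
@[simp] theorem L2.ev_apply (p q : ℤ) (a : L2) :
    L2.ev p q a = Multiplicative.ofAdd (p * a.y + q * a.x) := rfl

/-- The homomorphism `p·y + q·x` extended to `L₂^gp`. [cite: MochizukiFrdI2008, Def. 1.1(i) p.19] -/
noncomputable def Ev (p q : ℤ) : Algebra.GrothendieckGroup L2 →* Multiplicative ℤ :=
  Algebra.GrothendieckGroup.lift (L2.ev p q)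

/-- `Ev` on the image of `L₂`. [cite: MochizukiFrdI2008, Def. 1.1(i) p.19] -/
@[simp] theorem Ev_of (p q : ℤ) (a : L2) :
    Ev p q (Algebra.GrothendieckGroup.of a) = Multiplicative.ofAdd (p * a.y + q * a.x) := lift_of _ _

/-- `Ev` after the shear `σₘ`: `(p, q) ↦ (p − q·m, q)`. [cite: MochizukiFrdI2008, Def. 1.1(ii) p.19] -/
theorem Ev_map_shear (p q m : ℤ) (z : Algebra.GrothendieckGroup L2) :
    Ev p q (MonGp.map (L2.shear m) z) = Ev (p - q * m) q z := by
  have h : (Ev p q).comp (MonGp.map (L2.shear m)) = Ev (p - q * m) q :=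
    MonGp.hom_ext fun a => by
      simp only [MonoidHom.comp_apply, MonGp.map_of, Ev_of, L2.shear_y, L2.shear_x]
      congr 1
      ring
  exact DFunLike.congr_fun h z

/-- `Ev` after `Φ(f)^gp` for `f : E₀ → P`. [cite: MochizukiFrdI2008, Prop. 1.6(vi) p.27] -/
theorem Ev_pullGp_E0P (p q : ℤ) (f : BObj.E0 ⟶ BObj.P) (z : Algebra.GrothendieckGroup L2) :
    Ev p q (pullGp Phi f z) = Ev (p - q * f.val) q z :=
  Ev_map_shear p q f.val z

/-- `Ev` after `Φ(f)^gp` for `f : E₀ → E₀`. [cite: MochizukiFrdI2008, Prop. 1.6(vi) p.27] -/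
theorem Ev_pullGp_E0E0 (p q : ℤ) (f : BObj.E0 ⟶ BObj.E0) (z : Algebra.GrothendieckGroup L2) :
    Ev p q (pullGp Phi f z) = Ev (p - q * f.val) q z :=
  Ev_map_shear p q f.val z

end AutSubAmpleCex

end Literature.AlgebraicGeometry.Frobenioids
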